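import Literature.NumberTheory.GaloisRepresentations.LocalWeilDatumUnramified
import Literature.NumberTheory.GaloisRepresentations.UnramifiedKummer
import Literature.NumberTheory.GaloisRepresentations.InertiaRootsOfUnity
import HarnessLib

/-!
# The unramified level `F_n = F(ζ_{q^n-1})` lies in `F^nr`, and a Weil element fixes `F_n` iff `n ∣ deg w`
# (the unramified base `E := F_f` of de Shalit II.4's relative Coleman theory: `E ≤ maxUnramified F` and the hypothesis `hdegE`)

Topic `NumberTheory/GaloisRepresentations`; proof file (three theorems: no definition, no named fact, no instance).
The one-`𝔓` assembly of de Shalit II.4.12 (`Summit…PrintCf2RubinValueTwoEllipticUnitsLocalMeasure`, cf2c-w4 g10) and the files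
`RayClassFieldLocalTower{Containment,Disjoint,Norm}` take an unramified Galois base `E ⊆ K̄_v` of the relative Lubin–Tate theory
(de Shalit I.3.8 / II.4.3: `Φ = K_𝔭 · ι(K(𝔣))`, unramified of degree `f` = the order of `𝔭` in the ray class group mod `𝔣`) through the
two hypotheses `hE : E ≤ maxUnramified K_v` and `hdegE : ∀ w ∈ W_{K_v}, toAbsGalois w ∈ E.fixingSubgroup → (f : ℤ) ∣ deg w`.
For the tree's canonical unramified extension of degree `n`, `LocalWeilDatum.unramifiedLevel F n = F(ζ_n)` (`ζ_n` a primitive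
`(q^n − 1)`-th root of unity; finite, cyclic of degree `n`, Galois: `LocalUnitsUnramifiedFrame`), both hold:

* ★ `unramifiedLevel_le_maxUnramified` — **`F_n ≤ F^nr`** (`F^nr = F(μ_{p'})` by definition and `q^n − 1` is a unit of `𝒪_F`);
* ★ `dvd_deg_of_toAbsGalois_mem_fixingSubgroup_unramifiedLevel` — **a local Weil element fixing `F_n` has `n ∣ deg w`** — the
  hypothesis `hdegE` VERBATIM for `E := F_n`, `f := n` — and the converse `toAbsGalois_mem_fixingSubgroup_unramifiedLevel_of_dvd_deg`
  (both from `LocalWeilDatum.fieldSubgroup_unramifiedLevel : W_F ∩ G_{F_n} = deg⁻¹(nℤ)`).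

## References
* [deShalit1987] E. de Shalit, *Iwasawa theory of elliptic curves with complex multiplication* (1987), I.3.8 (p. 20), II.4.3 (p. 57).
* [SerreLocalFields1979] J.-P. Serre, *Local Fields* (1979), Ch. IV §4, Prop. 16 and Cor. 2.
* [NeukirchANT1999] J. Neukirch, *Algebraic Number Theory* (1999), Ch. IV §4 (`d_K : W_K → ℤ̂`, `f_K ∣ deg`).
-/

noncomputable section

open Field ValuativeRel

namespace Literature.NumberTheory.GaloisRepresentations

namespace IsNonarchimedeanLocalField

open LocalWeilDatum

variable (F : Type*) [Field F] [ValuativeRel F] [TopologicalSpace F] [IsNonarchimedeanLocalField F]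

/-- ★ **`F_n = F(ζ_{q^n−1}) ≤ F^nr`**: the unramified level of degree `n ≥ 1` lies in the maximal unramified extension
`F^nr = F(μ_{p'})` (`ζ_n` has order `q^n − 1`, a unit of `𝒪_F`) — the hypothesis `hE` of the relative Coleman / Lubin–Tate files
for `E := F_n`. [cite: SerreLocalFields1979, Ch. IV §4 Cor. 2 to Prop. 16] [cite: deShalit1987, I.3.8 (p. 20)] -/
theorem unramifiedLevel_le_maxUnramified {n : ℕ} (hn : 0 < n) : unramifiedLevel F n ≤ maxUnramified F := by
  refine IntermediateField.adjoin.mono F _ _ (Set.singleton_subset_iff.mpr ?_)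
  exact ⟨_, isUnit_natCast_residueFieldCard_pow_sub_one F hn.ne', (isPrimitiveRoot_rootOfUnramifiedLevel F hn).pow_eq_one⟩

/-- ★ **`hdegE` for `E := F_n`**: a local Weil element whose image in `Γ_F` fixes the unramified level `F_n` (`n ≥ 1`) has degree
divisible by `n` (`W_F ∩ G_{F_n} = deg⁻¹(nℤ)`). [cite: NeukirchANT1999, Ch. IV §4] [cite: SerreLocalFields1979, Ch. IV §4 Cor. to Prop. 16] -/
theorem dvd_deg_of_toAbsGalois_mem_fixingSubgroup_unramifiedLevel {n : ℕ} (hn : 0 < n) (w : WeilGroup F)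
    (hw : WeilGroup.toAbsGalois F w ∈ (unramifiedLevel F n).fixingSubgroup) : (n : ℤ) ∣ WeilGroup.deg w := by
  have h : w ∈ fieldSubgroup F (unramifiedLevel F n) :=
    (mem_fieldSubgroup_iff F).mpr ((IntermediateField.mem_fixingSubgroup_iff _ _).mp hw)
  rwa [fieldSubgroup_unramifiedLevel F hn, AbstractCFT.mem_degMultiples_iff, degZ_degHom] at h

/-- Conversely, a local Weil element with `n ∣ deg w` fixes `F_n`. [cite: NeukirchANT1999, Ch. IV §4] -/
theorem toAbsGalois_mem_fixingSubgroup_unramifiedLevel_of_dvd_deg {n : ℕ} (hn : 0 < n) (w : WeilGroup F)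
    (hw : (n : ℤ) ∣ WeilGroup.deg w) : WeilGroup.toAbsGalois F w ∈ (unramifiedLevel F n).fixingSubgroup := by
  have h : w ∈ fieldSubgroup F (unramifiedLevel F n) := by
    rw [fieldSubgroup_unramifiedLevel F hn, AbstractCFT.mem_degMultiples_iff, degZ_degHom]
    exact hw
  exact (IntermediateField.mem_fixingSubgroup_iff _ _).mpr ((mem_fieldSubgroup_iff F).mp h)

end IsNonarchimedeanLocalField

end Literature.NumberTheory.GaloisRepresentations

end
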